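import Summits.QuantumFields.YangMills.Theorems.UnitScaleTiltProp7CovKernelTowerLetters
import HarnessLib

/-!
# Route `UnitScaleTilt`, crux K1 «MinimiserStabilityRegPr» (stmt-QuantumFields-19200), EX display row (157)-twˢ `hC157`, C-ENTRY line, file F-4b —
# **[Balaban1985Averaging] PROP. 5 (157) AT A CURVED BACKGROUND: THE PER-BOND KERNEL OF THE DERIVATIVE OF THE COVARIANT LOG-COORDINATE TOWER BEYOND ITS LINEAR PART**
# `‖∂_t|₀ F_J(B + tδ)(c) − (Lin_J δ)(c)‖ ≤ C·(2L^J‖B‖)·(2(L·L^{−d})^J‖δ‖)` for the tower of a plaquette-small SU(2) background — the assembly of ✓`ChartKernelTower.kernel_tower_bound_le` +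
# ✓`tower_deriv_recursion` (print (149)–(155)) with `hT` = F-2, `hE` = F-3a, sizes = F-3b, `ha`∕`hSa` = F-4a (✓`LeakyLinearTower`), supports by locality.

Cell `ym3-torus` (HUMAN RULING D-0037: YM₃ on T³ is ladder rung R3, not the Clay problem), width seat `ym3-torus-px18` gen 3; ★w2-19200 g8 «C-ENTRY GO».  `--supports
stmt-QuantumFields-19200 --as helper`; def-free, 0 sorry; count-neutral.

LETTERS.  `PlaqSmall a₀ U₀`, `Ū₀ˡ = emlIterU l U₀♭`, the field-valued one-step charts `f_l`, the iterate `Fm` (✓`Prop7CovLogTower.exists_iterate` letters) and the composed linear parts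
`Lin` (✓`exists_lin` letters), budgets VERBATIM from ★routeR-w3∕w6 (`6400ℓ²Lˡs_B ≤ 1`, `10⁷ℓ²ρ ≤ 1`, `4s₀(l) < ρ`, `1000ℓ(2s₀(l)+3R) ≤ 1`), `s₀(l) = 30ℓLˡ·2d(3L^{l+1} − 1)a₀`,
`c_R(l) = 16(12Lρ)∕ρ²·2s₀(l)`, `B_l = L·3R + 22100ℓ²(s₀(l)+(s₀(l)+3R))²`; `λ := L·(Lᵈ)⁻¹`; numeric letters `θ₀ ≥ 2λ + c_R(J−1)`, `G ≥ 64B_{J−1}/R²`,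
`A′ := G·2d∕(L·λ)`, `θ := θ₀∕(L·λ)`, `δ′ := A′·(2L^J‖B‖)`, window `θ + δ′ < 1`.
(letters `s0_mono`, `supports_iterate_const`, `norm_fderiv_rem_apply_le_of_plaqSmall`, `norm_fderiv_apply_le_theta_of_plaqSmall` in ✓`Prop7CovKernelTowerLetters`.)
§2 ★★★ `hasDerivAt_iterate_kernel_bound_of_plaqSmall` — `3 ≤ L`, `J + 1 ≤ m_P + K_P`, the budgets (`l < J`), `8L^J‖B‖ ≤ R`, F-3b's two summability windows, F-4a's window, the kernel window
`θ + δ′ < 1`; `δ` vanishing off the fine bond `b₀`.  Then there is `vd` with `HasDerivAt (t ↦ Fm J (B + t•δ)) vd 0` and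
**`‖vd(c) − (Lin J δ)(c)‖ ≤ A′/(1 − θ − δ′)·(2L^J‖B‖)·(2λ^J‖δ‖)` for every level-`J` bond `c`** — print's `|δC_k∕δA_b| ≤ C₃|A|` with the tube scale, at a CURVED background
(in d = 3: `L^J·L^{−2J} = L^{−J}` = the `(L^{K−n})⁻¹` of `hC157`).
HONEST SCOPE.  Assembly of landed∕pending bricks; constants crude and DISPLAYED; the T³ reading (`CmapTwS = Fm − Lin` at the top by ✓`CmapTwS_apply_eq_iterate_sub_lin`, `RegPr ⇒ PlaqSmall`,
numerals) ⇒ `hC157` is the NEXT file (F-5); nothing of `hC157`, EX, E′ or the crux is claimed here; rung R3, not d = 4; YM gap NOT proved.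

References: T. Bałaban, CMP **98** (1985) 17–51 [Balaban1985Averaging] ((87)–(92) p.31, (124)–(127) p.36, (139)–(157) pp.39–42, (161)–(163) p.42).
-/

noncomputable section

open scoped BigOperators Matrix.Norms.L2Operator
open NormedSpace Metric Set Finset Filter Topology

namespace Summit.QuantumFields.YangMills.Theorems.Prop7CovKernelTowerAssembly

open Literature.MathematicalPhysics.QuantumFieldTheory.Balaban1983to89
open T4Continuum BlockAveraging AveragingRT ExpMeanLog
open B5Eq118OneStroke (iterBlockOf iterBlockOf_succ iterBlockOf_zero)
open B15DeterminingSets (embIter)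
open B7Prop1Explicit (expUnit val_expUnit U1 mem_U1)
open MatrixLog (mlog)
open B10Eq27TorusAxialLog (axialT gaugeActT gaugeActT_apply unitsField toUField suIncl)
open Summit.QuantumFields.YangMills.Theorems.Prop8Chart (emlAvgU emlIterU)
open Summit.QuantumFields.YangMills.Theorems.Prop7SymAvgTwSym (dbarCovU)
open Summit.QuantumFields.YangMills.Theorems.Prop7TwistedOneStepDefectCov (chart_congr)
open Summit.QuantumFields.YangMills.Theorems.Prop7CovKernelOneStep (norm_fderiv_chartField_apply_le_of_endpoint_of_plaqSmall)
open Summit.QuantumFields.YangMills.Theorems.Prop7CovKernel148 (differentiableAt_chart_of_plaqSmall norm_fderiv_chart_sub_fderiv_zero_le_of_plaqSmall)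
open Summit.QuantumFields.YangMills.Theorems.Prop7CovOrbitSizes (norm_iterate_le_of_plaqSmall)
open Summit.QuantumFields.YangMills.Theorems.Prop7CovLinearTowerProfile (norm_lin_apply_le_of_plaqSmall reads_of_endpoint s0_mul_pow_le)
open Summit.QuantumFields.YangMills.Theorems.ChartKernelTower (kernel_tower_bound_le tower_deriv_recursion)
open Summit.QuantumFields.YangMills.Theorems.ChartKernelTube (card_le_two_mul_d_of_endpoint)
open Summit.QuantumFields.YangMills.Theorems.Prop7CovKernelTowerLetters (s0_mono supports_iterate_const norm_fderiv_rem_apply_le_of_plaqSmall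
  norm_fderiv_apply_le_theta_of_plaqSmall)

variable {P : Params}

/-! ## The assembly -/

set_option maxHeartbeats 400000 in
/-- ★★★ **PROP. 5 (157) AT A CURVED BACKGROUND — THE KERNEL OF THE DERIVATIVE OF THE TOWER BEYOND ITS LINEAR PART.**  `3 ≤ L`, `J + 1 ≤ m_P + K_P`, `PlaqSmall a₀ U₀`, the one-step
budgets for `l < J`, the iterate `Fm` and linear parts `Lin` of the covariant log-coordinate tower, `8L^J‖B‖ ≤ R`, F-3b's summability windows, F-4a's window, numeric letters
`θ₀ ≥ 2λ + c_R(J−1)`, `G ≥ 64B_{J−1}/R²` (`λ = L(Lᵈ)⁻¹`) with the kernel window `θ₀/(Lλ) + (G·2d/(Lλ))·(2L^J‖B‖) < 1`; `δ` vanishing off `b₀`.  Then `t ↦ Fm J (B + t•δ)` is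
differentiable at `0` with derivative `vd`, and for every level-`J` bond `c`
**`‖vd c − (Lin J δ) c‖ ≤ (G·2d/(Lλ))/(1 − θ₀/(Lλ) − (G·2d/(Lλ))·(2L^J‖B‖))·(2L^J‖B‖)·(2λ^J‖δ‖)`**. [cite: Balaban1985Averaging, (147)-(157) pp.40-42] -/
theorem hasDerivAt_iterate_kernel_bound_of_plaqSmall (hL3 : 3 ≤ P.L) {J : ℕ} (hJ : J + 1 ≤ P.m + P.K)
    (U₀ : GaugeField P 0 (Matrix.specialUnitaryGroup (Fin 2) ℂ)) {a₀ : ℝ} (ha₀ : 0 < a₀) (hU : PlaqSmall a₀ U₀)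
    (hbud₀ : ∀ l, l < J → 6400 * (((P.d + 2) * P.L : ℕ) : ℝ) ^ 2 * (P.L : ℝ) ^ l * (2 * ((P.d : ℝ) * (3 * (P.L : ℝ) ^ (l + 1) - 1)) * a₀) ≤ 1)
    {ρ : ℝ} (hρ0 : 0 < ρ) (hbudget : 10000000 * (((P.d + 2) * P.L : ℕ) : ℝ) ^ 2 * ρ ≤ 1) (hs₀ρ : ∀ l, l < J → 4 * (30 * (((P.d + 2) * P.L : ℕ) : ℝ) * (P.L : ℝ) ^ l * (2 * ((P.d : ℝ) * (3 * (P.L : ℝ) ^ (l + 1) - 1)) * a₀)) < ρ)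
    {R : ℝ} (hR : 0 < R) (hwin : ∀ l, l < J → 1000 * (((P.d + 2) * P.L : ℕ) : ℝ) * (2 * (30 * (((P.d + 2) * P.L : ℕ) : ℝ) * (P.L : ℝ) ^ l * (2 * ((P.d : ℝ) * (3 * (P.L : ℝ) ^ (l + 1) - 1)) * a₀)) + 3 * R) ≤ 1)
    (Fm : (m : ℕ) → (PBond P 0 → Matrix (Fin 2) (Fin 2) ℂ) → (PBond P m → Matrix (Fin 2) (Fin 2) ℂ)) (hF0 : ∀ x, Fm 0 x = x)
    (hFs : ∀ (l : ℕ) (x : PBond P 0 → Matrix (Fin 2) (Fin 2) ℂ), Fm (l + 1) x = (fun (y : PBond P l → Matrix (Fin 2) (Fin 2) ℂ) (c : PBond P (l + 1)) =>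
          mlog (((dbarCovU (emlIterU l (unitsField (toUField U₀))) (fun b => expUnit (y b) * emlIterU l (unitsField (toUField U₀)) b) c :
              (Matrix (Fin 2) (Fin 2) ℂ)ˣ) : Matrix (Fin 2) (Fin 2) ℂ) *
            (((emlAvgU (emlIterU l (unitsField (toUField U₀))) c)⁻¹ : (Matrix (Fin 2) (Fin 2) ℂ)ˣ) : Matrix (Fin 2) (Fin 2) ℂ))) (Fm l x))
    (Lin : (m : ℕ) → (PBond P 0 → Matrix (Fin 2) (Fin 2) ℂ) →L[ℂ] (PBond P m → Matrix (Fin 2) (Fin 2) ℂ)) (hLin0 : Lin 0 = ContinuousLinearMap.id ℂ (PBond P 0 → Matrix (Fin 2) (Fin 2) ℂ))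
    (hLins : ∀ l : ℕ, Lin (l + 1) = (fderiv ℂ (fun (y : PBond P l → Matrix (Fin 2) (Fin 2) ℂ) (c : PBond P (l + 1)) =>
          mlog (((dbarCovU (emlIterU l (unitsField (toUField U₀))) (fun b => expUnit (y b) * emlIterU l (unitsField (toUField U₀)) b) c :
              (Matrix (Fin 2) (Fin 2) ℂ)ˣ) : Matrix (Fin 2) (Fin 2) ℂ) *
            (((emlAvgU (emlIterU l (unitsField (toUField U₀))) c)⁻¹ : (Matrix (Fin 2) (Fin 2) ℂ)ˣ) : Matrix (Fin 2) (Fin 2) ℂ))) 0).comp (Lin l))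
    (B : PBond P 0 → Matrix (Fin 2) (Fin 2) ℂ) (hB : 8 * (P.L : ℝ) ^ J * ‖B‖ ≤ R)
    (hsumR : ∑ l ∈ Finset.range J, (16 * (12 * (P.L : ℝ) * ρ) / ρ ^ 2 * (2 * (30 * (((P.d + 2) * P.L : ℕ) : ℝ) * (P.L : ℝ) ^ l * (2 * ((P.d : ℝ) * (3 * (P.L : ℝ) ^ (l + 1) - 1)) * a₀)))) ≤ (P.L : ℝ) / 4)
    (hsumD : ∑ l ∈ Finset.range J, (80 * ((P.L : ℝ) * (3 * R) + 22100 * (((P.d + 2) * P.L : ℕ) : ℝ) ^ 2 * ((30 * (((P.d + 2) * P.L : ℕ) : ℝ) * (P.L : ℝ) ^ l * (2 * ((P.d : ℝ) * (3 * (P.L : ℝ) ^ (l + 1) - 1)) * a₀)) + ((30 * (((P.d + 2) * P.L : ℕ) : ℝ) * (P.L : ℝ) ^ l * (2 * ((P.d : ℝ) * (3 * (P.L : ℝ) ^ (l + 1) - 1)) * a₀)) + 3 * R)) ^ 2) / R ^ 2) * (2 * P.d * (P.L : ℝ) ^ P.d) * (2 * (P.L : ℝ) ^ l * ‖B‖)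 ≤ (P.L : ℝ) / 4)
    (hg : 4 * (2 * (P.d : ℝ) * (16 * (12 * (P.L : ℝ) * ρ) / ρ ^ 2 * (2 * (30 * (((P.d + 2) * P.L : ℕ) : ℝ) * (P.L : ℝ) ^ (J - 1) * (2 * ((P.d : ℝ) * (3 * (P.L : ℝ) ^ ((J - 1) + 1) - 1)) * a₀)))) * (P.L : ℝ) ^ (P.d + 1)) * ((P.L : ℝ) ^ 2)⁻¹ ≤ 1)
    {θ₀ G : ℝ} (hθ₀ : 2 * ((P.L : ℝ) * ((P.L : ℝ) ^ P.d)⁻¹) + (16 * (12 * (P.L : ℝ) * ρ) / ρ ^ 2 * (2 * (30 * (((P.d + 2) * P.L : ℕ) : ℝ) * (P.L : ℝ) ^ (J - 1) * (2 * ((P.d : ℝ) * (3 * (P.L : ℝ) ^ ((J - 1) + 1) - 1)) * a₀)))) ≤ θ₀) (hGB : 64 * ((P.L : ℝ) * (3 * R) + 22100 * (((P.d + 2) * P.L : ℕ) : ℝ) ^ 2 * ((30 * (((P.d + 2) * P.L : ℕ) : ℝ) * (P.L : ℝ) ^ (J - 1) * (2 * ((P.d : ℝ) * (3 * (P.L :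 ℝ) ^ ((J - 1) + 1) - 1)) * a₀)) + ((30 * (((P.d + 2) * P.L : ℕ) : ℝ) * (P.L : ℝ) ^ (J - 1) * (2 * ((P.d : ℝ) * (3 * (P.L : ℝ) ^ ((J - 1) + 1) - 1)) * a₀)) + 3 * R)) ^ 2) / R ^ 2 ≤ G)
    (hwinK : θ₀ / ((P.L : ℝ) * ((P.L : ℝ) * ((P.L : ℝ) ^ P.d)⁻¹)) + (G * (2 * P.d) / ((P.L : ℝ) * ((P.L : ℝ) * ((P.L : ℝ) ^ P.d)⁻¹))) * (2 * (P.L : ℝ) ^ J * ‖B‖) < 1)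
    (b₀ : PBond P 0) (δ : PBond P 0 → Matrix (Fin 2) (Fin 2) ℂ) (hδ : ∀ b, b ≠ b₀ → δ b = 0) :
    ∃ vd : PBond P J → Matrix (Fin 2) (Fin 2) ℂ, HasDerivAt (fun t : ℂ => Fm J (B + t • δ)) vd 0 ∧
      ∀ c : PBond P J, ‖vd c - Lin J δ c‖ ≤
        (G * (2 * P.d) / ((P.L : ℝ) * ((P.L : ℝ) * ((P.L : ℝ) ^ P.d)⁻¹))) / (1 - θ₀ / ((P.L : ℝ) * ((P.L : ℝ) * ((P.L : ℝ) ^ P.d)⁻¹)) - (G * (2 * P.d) / ((P.L : ℝ) * ((P.L : ℝ) * ((P.L : ℝ) ^ P.d)⁻¹))) * (2 * (P.L : ℝ) ^ J * ‖B‖)) *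
          (2 * (P.L : ℝ) ^ J * ‖B‖) * (2 * ((P.L : ℝ) * ((P.L : ℝ) ^ P.d)⁻¹) ^ J * ‖δ‖) := by
  classical
  have hL1 : (1 : ℝ) ≤ P.L := by exact_mod_cast P.L_pos
  have hL3r : (3 : ℝ) ≤ P.L := by exact_mod_cast hL3
  have hL2 : 2 ≤ P.L := by omega
  have hLpos : (0 : ℝ) < P.L := by linarith
  have hs₀0 : ∀ l : ℕ, 0 ≤ (30 * (((P.d + 2) * P.L : ℕ) : ℝ) * (P.L : ℝ) ^ l * (2 * ((P.d : ℝ) * (3 * (P.L : ℝ) ^ (l + 1) - 1)) * a₀)) := by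
    intro l
    have h3 : (0 : ℝ) ≤ 3 * (P.L : ℝ) ^ (l + 1) - 1 := by linarith [one_le_pow₀ (n := l + 1) hL1]
    have ha := ha₀.le
    positivity
  have hcR0 : ∀ l : ℕ, 0 ≤ (16 * (12 * (P.L : ℝ) * ρ) / ρ ^ 2 * (2 * (30 * (((P.d + 2) * P.L : ℕ) : ℝ) * (P.L : ℝ) ^ l * (2 * ((P.d : ℝ) * (3 * (P.L : ℝ) ^ (l + 1) - 1)) * a₀)))) := fun l => by have := hs₀0 l; positivity
  -- letters
  set lam : ℝ := ((P.L : ℝ) * ((P.L : ℝ) ^ P.d)⁻¹) with hlam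
  have hlam0 : 0 < lam := by positivity
  set s : ℕ → ℝ := fun m => 2 * (P.L : ℝ) ^ m * ‖B‖ with hs
  set α : ℕ → ℝ := fun m => 2 * lam ^ m * ‖δ‖ with hα
  set A' : ℝ := G * (2 * P.d) / ((P.L : ℝ) * lam) with hA'
  set θ : ℝ := θ₀ / ((P.L : ℝ) * lam) with hθ
  set δ' : ℝ := A' * (2 * (P.L : ℝ) ^ J * ‖B‖) with hδ'
  have hG0 : 0 ≤ G := le_trans (by have := hs₀0 (J - 1); positivity) hGB
  have hθ₀0 : 0 ≤ θ₀ := le_trans (by have := hcR0 (J - 1); positivity) hθ₀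
  have hA'0 : 0 ≤ A' := by rw [hA']; positivity
  have hθδ : θ + δ' < 1 := hwinK
  -- sizes of the orbit
  have hsz := norm_iterate_le_of_plaqSmall hJ U₀ ha₀ hU hbud₀ hρ0 hbudget hs₀ρ hR hwin Fm hF0 hFs B hB hsumR hsumD
  have hszR : ∀ m, m ≤ J → ‖Fm m B‖ < R := by
    intro m hm
    have h1 := hsz m hm
    have hpow : (P.L : ℝ) ^ m ≤ (P.L : ℝ) ^ J := pow_le_pow_right₀ hL1 hm
    have : 2 * (P.L : ℝ) ^ m * ‖B‖ ≤ 2 * (P.L : ℝ) ^ J * ‖B‖ := by gcongr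
    have hBn : 0 ≤ (P.L : ℝ) ^ J * ‖B‖ := by positivity
    linarith
  have hsz8 : ∀ m, m < J → s m < R / 8 := by
    intro m hm
    have hpow : (P.L : ℝ) ^ (m + 1) ≤ (P.L : ℝ) ^ J := pow_le_pow_right₀ hL1 (by omega)
    rw [pow_succ] at hpow
    have hBn : 0 ≤ ‖B‖ := norm_nonneg _
    have h1 : (P.L : ℝ) ^ m * (P.L : ℝ) * ‖B‖ ≤ (P.L : ℝ) ^ J * ‖B‖ := mul_le_mul_of_nonneg_right hpow hBn
    have h2 : 3 * ((P.L : ℝ) ^ m * ‖B‖) ≤ (P.L : ℝ) ^ m * (P.L : ℝ) * ‖B‖ := by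
      have : 0 ≤ (P.L : ℝ) ^ m * ‖B‖ := by positivity
      nlinarith
    show 2 * (P.L : ℝ) ^ m * ‖B‖ < R / 8
    nlinarith
  -- the complex lines and the tower along them
  set V : (m : ℕ) → ℂ → (PBond P m → Matrix (Fin 2) (Fin 2) ℂ) := fun m t => Fm m (B + t • δ) with hV
  have hV0 : ∀ t, V 0 t = B + t • δ := fun t => hF0 _
  have hVs : ∀ m t, V (m + 1) t = (fun (y : PBond P m → Matrix (Fin 2) (Fin 2) ℂ) (c : PBond P (m + 1)) =>
          mlog (((dbarCovU (emlIterU m (unitsField (toUField U₀))) (fun b => expUnit (y b) * emlIterU m (unitsField (toUField U₀)) b) c :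
              (Matrix (Fin 2) (Fin 2) ℂ)ˣ) : Matrix (Fin 2) (Fin 2) ℂ) *
            (((emlAvgU (emlIterU m (unitsField (toUField U₀))) c)⁻¹ : (Matrix (Fin 2) (Fin 2) ℂ)ˣ) : Matrix (Fin 2) (Fin 2) ℂ))) (V m t) := fun m t => hFs m _
  have hVm0 : ∀ m, V m 0 = Fm m B := fun m => by simp only [hV, zero_smul, add_zero]
  have hΦdiff : ∀ m, m < J → DifferentiableAt ℂ (fun (y : PBond P m → Matrix (Fin 2) (Fin 2) ℂ) (c : PBond P (m + 1)) =>
          mlog (((dbarCovU (emlIterU m (unitsField (toUField U₀))) (fun b => expUnit (y b) * emlIterU m (unitsField (toUField U₀)) b) c :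
              (Matrix (Fin 2) (Fin 2) ℂ)ˣ) : Matrix (Fin 2) (Fin 2) ℂ) *
            (((emlAvgU (emlIterU m (unitsField (toUField U₀))) c)⁻¹ : (Matrix (Fin 2) (Fin 2) ℂ)ˣ) : Matrix (Fin 2) (Fin 2) ℂ))) (V m 0) := by
    intro m hm
    rw [hVm0]
    refine differentiableAt_pi.2 fun c => ?_
    exact differentiableAt_chart_of_plaqSmall (by omega) U₀ ha₀ hU (hbud₀ m hm) (hwin m hm) c (hszR m hm.le)
  obtain ⟨vd, hder, hk0, hrec⟩ := tower_deriv_recursion (fun m => PBond P m) J (fun m => (fun (y : PBond P m → Matrix (Fin 2) (Fin 2) ℂ) (c : PBond P (m + 1)) =>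
          mlog (((dbarCovU (emlIterU m (unitsField (toUField U₀))) (fun b => expUnit (y b) * emlIterU m (unitsField (toUField U₀)) b) c :
              (Matrix (Fin 2) (Fin 2) ℂ)ˣ) : Matrix (Fin 2) (Fin 2) ℂ) *
            (((emlAvgU (emlIterU m (unitsField (toUField U₀))) c)⁻¹ : (Matrix (Fin 2) (Fin 2) ℂ)ˣ) : Matrix (Fin 2) (Fin 2) ℂ))))
    (fun m => fderiv ℂ (fun (y : PBond P m → Matrix (Fin 2) (Fin 2) ℂ) (c : PBond P (m + 1)) =>
          mlog (((dbarCovU (emlIterU m (unitsField (toUField U₀))) (fun b => expUnit (y b) * emlIterU m (unitsField (toUField U₀)) b) c :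
              (Matrix (Fin 2) (Fin 2) ℂ)ˣ) : Matrix (Fin 2) (Fin 2) ℂ) *
            (((emlAvgU (emlIterU m (unitsField (toUField U₀))) c)⁻¹ : (Matrix (Fin 2) (Fin 2) ℂ)ˣ) : Matrix (Fin 2) (Fin 2) ℂ))) 0) Lin hLin0 hLins V B δ hV0 hVs hΦdiff
  -- reader sets
  set S : (m : ℕ) → Finset (PBond P m) := fun m => univ.filter fun c : PBond P m => c.src = iterBlockOf m b₀.src ∨ c.tgt = iterBlockOf m b₀.src with hS
  have hSmem : ∀ (m : ℕ) (c : PBond P m), c ∈ S m ↔ (c.src = iterBlockOf m b₀.src ∨ c.tgt = iterBlockOf m b₀.src) := fun m c => by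
    rw [hS, Finset.mem_filter]; exact ⟨fun h => h.2, fun h => ⟨Finset.mem_univ _, h⟩⟩
  have hSend : ∀ m, ∀ c' ∈ S m, c'.src = iterBlockOf m b₀.src ∨ c'.tgt = iterBlockOf m b₀.src := fun m c' hc' => (hSmem m c').1 hc'
  -- the linear tower (F-4a)
  have hlin := norm_lin_apply_le_of_plaqSmall hL2 hJ U₀ ha₀ hU hbud₀ hρ0 hbudget hs₀ρ hg Lin hLin0 hLins b₀ δ hδ
  -- the abstract induction
  set k : (m : ℕ) → PBond P m → Matrix (Fin 2) (Fin 2) ℂ := fun m => vd m - Lin m δ with hk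
  set a : (m : ℕ) → PBond P m → Matrix (Fin 2) (Fin 2) ℂ := fun m c' => Lin m δ c' with ha
  have hmain := kernel_tower_bound_le J (fun m => PBond P m) k a (fun m w c => (fderiv ℂ (fun (y : PBond P m → Matrix (Fin 2) (Fin 2) ℂ) (c : PBond P (m + 1)) =>
          mlog (((dbarCovU (emlIterU m (unitsField (toUField U₀))) (fun b => expUnit (y b) * emlIterU m (unitsField (toUField U₀)) b) c :
              (Matrix (Fin 2) (Fin 2) ℂ)ˣ) : Matrix (Fin 2) (Fin 2) ℂ) *
            (((emlAvgU (emlIterU m (unitsField (toUField U₀))) c)⁻¹ : (Matrix (Fin 2) (Fin 2) ℂ)ˣ) : Matrix (Fin 2) (Fin 2) ℂ))) 0 w) c)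
    (fun m w c => fderiv ℂ (fun W => (fun (y : PBond P m → Matrix (Fin 2) (Fin 2) ℂ) (c : PBond P (m + 1)) =>
          mlog (((dbarCovU (emlIterU m (unitsField (toUField U₀))) (fun b => expUnit (y b) * emlIterU m (unitsField (toUField U₀)) b) c :
              (Matrix (Fin 2) (Fin 2) ℂ)ˣ) : Matrix (Fin 2) (Fin 2) ℂ) *
            (((emlAvgU (emlIterU m (unitsField (toUField U₀))) c)⁻¹ : (Matrix (Fin 2) (Fin 2) ℂ)ˣ) : Matrix (Fin 2) (Fin 2) ℂ))) W - (fderiv ℂ (fun (y : PBond P m → Matrix (Fin 2) (Fin 2) ℂ) (c : PBond P (m + 1)) =>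
          mlog (((dbarCovU (emlIterU m (unitsField (toUField U₀))) (fun b => expUnit (y b) * emlIterU m (unitsField (toUField U₀)) b) c :
              (Matrix (Fin 2) (Fin 2) ℂ)ˣ) : Matrix (Fin 2) (Fin 2) ℂ) *
            (((emlAvgU (emlIterU m (unitsField (toUField U₀))) c)⁻¹ : (Matrix (Fin 2) (Fin 2) ℂ)ˣ) : Matrix (Fin 2) (Fin 2) ℂ))) 0) W) (V m 0) w c) S s α
    (θ₀ := θ₀) (G := G) (L := (P.L : ℝ)) (lam := lam) (θ := θ) (A' := A') (δ := δ') (ν := 2 * P.d)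
    hA'0 hθδ hlam0.le hLpos.le hG0 (fun m => by simp only [hs]; positivity) (fun m => by simp only [hα]; positivity)
    (fun m _ => by simp only [hs, pow_succ]; nlinarith [norm_nonneg B, pow_pos hLpos m])
    (fun m _ => by simp only [hα, pow_succ]; ring)
    (by rw [hθ, div_mul_cancel₀ _ (by positivity)])
    (by rw [hA']; push_cast; rw [div_mul_cancel₀ _ (by positivity)])
    (fun m hm => by
      show A' * (2 * (P.L : ℝ) ^ m * ‖B‖) ≤ A' * (2 * (P.L : ℝ) ^ J * ‖B‖)
      have hpow : (P.L : ℝ) ^ m ≤ (P.L : ℝ) ^ J := pow_le_pow_right₀ hL1 hm.le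
      have : 2 * (P.L : ℝ) ^ m * ‖B‖ ≤ 2 * (P.L : ℝ) ^ J * ‖B‖ := by gcongr
      exact mul_le_mul_of_nonneg_left this hA'0)
    (fun c => congrFun hk0 c)
    (fun m hm c _ => hrec m hm c)
    (fun m hm c _ w β hβ hw hwβ => norm_fderiv_apply_le_theta_of_plaqSmall hm (by omega) U₀ ha₀ hU (hbud₀ m hm) hρ0 hbudget (hs₀ρ m hm) hθ₀
      (iterBlockOf m b₀.src) (S m) (hSend m) w hw hβ hwβ c)
    (fun m hm c _ w hw => by
      have hBm : ((P.L : ℝ) * (3 * R) + 22100 * (((P.d + 2) * P.L : ℕ) : ℝ) ^ 2 * ((30 * (((P.d + 2) * P.L : ℕ) : ℝ) * (P.L : ℝ) ^ m * (2 * ((P.d : ℝ) * (3 * (P.L : ℝ) ^ (m + 1) - 1)) * a₀)) + ((30 * (((P.d + 2) * P.L : ℕ) : ℝ) * (P.L : ℝ) ^ m * (2 * ((P.d : ℝ) * (3 * (P.L : ℝ) ^ (m + 1) - 1)) * a₀)) + 3 * R)) ^ 2) ≤ ((P.L : ℝ) * (3 * R) + 22100 * (((P.d + 2) * P.L : ℕ)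 : ℝ) ^ 2 * ((30 * (((P.d + 2) * P.L : ℕ) : ℝ) * (P.L : ℝ) ^ (J - 1) * (2 * ((P.d : ℝ) * (3 * (P.L : ℝ) ^ ((J - 1) + 1) - 1)) * a₀)) + ((30 * (((P.d + 2) * P.L : ℕ) : ℝ) * (P.L : ℝ) ^ (J - 1) * (2 * ((P.d : ℝ) * (3 * (P.L : ℝ) ^ ((J - 1) + 1) - 1)) * a₀)) + 3 * R)) ^ 2) := by
        have hmono := s0_mono (P := P) hL1 ha₀.le hm
        have h1 : 0 ≤ (30 * (((P.d + 2) * P.L : ℕ) : ℝ) * (P.L : ℝ) ^ m * (2 * ((P.d : ℝ) * (3 * (P.L : ℝ) ^ (m + 1) - 1)) * a₀)) + ((30 * (((P.d + 2) * P.L : ℕ) : ℝ) * (P.L : ℝ) ^ m * (2 * ((P.d : ℝ) * (3 * (P.L : ℝ) ^ (m + 1) - 1)) * a₀)) + 3 * R) := by have := hs₀0 m; positivity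
        have h2 : (30 * (((P.d + 2) * P.L : ℕ) : ℝ) * (P.L : ℝ) ^ m * (2 * ((P.d : ℝ) * (3 * (P.L : ℝ) ^ (m + 1) - 1)) * a₀)) + ((30 * (((P.d + 2) * P.L : ℕ) : ℝ) * (P.L : ℝ) ^ m * (2 * ((P.d : ℝ) * (3 * (P.L : ℝ) ^ (m + 1) - 1)) * a₀)) + 3 * R) ≤ (30 * (((P.d + 2) * P.L : ℕ) : ℝ) * (P.L : ℝ) ^ (J - 1) * (2 * ((P.d : ℝ) * (3 * (P.L : ℝ) ^ ((J - 1) + 1) - 1)) * a₀)) + ((30 * (((P.d + 2) * P.L : ℕ) : ℝ) * (P.L : ℝ) ^ (J - 1) * (2 * ((P.d : ℝ) * (3 * (P.L : ℝ) ^ ((J - 1) + 1) - 1)) * a₀)) + 3 * R) := by linarith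
        have h3 := mul_self_le_mul_self h1 h2
        rw [← sq, ← sq] at h3
        nlinarith [h3]
      have hGm : 64 * ((P.L : ℝ) * (3 * R) + 22100 * (((P.d + 2) * P.L : ℕ) : ℝ) ^ 2 * ((30 * (((P.d + 2) * P.L : ℕ) : ℝ) * (P.L : ℝ) ^ m * (2 * ((P.d : ℝ) * (3 * (P.L : ℝ) ^ (m + 1) - 1)) * a₀)) + ((30 * (((P.d + 2) * P.L : ℕ) : ℝ) * (P.L : ℝ) ^ m * (2 * ((P.d : ℝ) * (3 * (P.L : ℝ) ^ (m + 1) - 1)) * a₀)) + 3 * R)) ^ 2) / R ^ 2 ≤ G := le_trans (div_le_div_of_nonneg_right (by linarith) (by positivity)) hGB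
      rw [hVm0]
      exact norm_fderiv_rem_apply_le_of_plaqSmall (by omega) U₀ ha₀ hU (hbud₀ m hm) hR (by simp only [hs]; positivity) (hsz8 m hm) (hwin m hm) hGm
        (hsz m hm.le) (S m) w hw c)
    (fun m _ => card_le_two_mul_d_of_endpoint (iterBlockOf m b₀.src) (S m) (hSend m))
    (fun m hm c' hc' => (hlin m hm.le).2 c' fun h => hc' ((hSmem m c').2 h))
    (fun m hm c' hc' => by
      have hnot : ¬ (c'.src = iterBlockOf m b₀.src ∨ c'.tgt = iterBlockOf m b₀.src) := fun h => hc' ((hSmem m c').2 h)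
      have ha0 : Lin m δ c' = 0 := (hlin m hm).2 c' hnot
      have hconstV : ∀ t : ℂ, V m t c' = V m 0 c' := fun t => by
        show Fm m (B + t • δ) c' = Fm m (B + (0 : ℂ) • δ) c'
        rw [supports_iterate_const U₀ Fm hF0 hFs B b₀ δ hδ t m (hm.trans (by omega)) c' hnot,
          supports_iterate_const U₀ Fm hF0 hFs B b₀ δ hδ 0 m (hm.trans (by omega)) c' hnot]
      have hconst : HasDerivAt (fun t : ℂ => V m t c') 0 0 := by
        have : (fun t : ℂ => V m t c') = fun _ => V m 0 c' := funext hconstV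
        rw [this]; exact hasDerivAt_const _ _
      have hcomp : HasDerivAt (fun t : ℂ => V m t c') (vd m c') 0 := (hasDerivAt_pi.mp (hder m hm)) c'
      have hvd0 : vd m c' = 0 := hcomp.unique hconst
      show (vd m - Lin m δ) c' = 0
      rw [Pi.sub_apply, hvd0, ha0, sub_zero])
    (fun m hm c' _ => by
      show ‖Lin m δ c'‖ ≤ 2 * lam ^ m * ‖δ‖
      have := (hlin m hm.le).1 c'
      rw [hlam]; linarith)
  refine ⟨vd J, hder J le_rfl, fun c => ?_⟩
  have h := hmain J le_rfl c
  exact h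

end Summit.QuantumFields.YangMills.Theorems.Prop7CovKernelTowerAssembly

end
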